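import Summits.QuantumFields.BalabanUV.Beta.EriceFlowEnclosureB12AsPrintedHistoryNonuniqueBandsData
import Summits.QuantumFields.BalabanUV.Beta.EriceFlowEnclosureB12AsPrintedHistoryNonuniqueSetting

/-!
# Beta / EriceFlowEnclosureB12AsPrintedHistoryNonuniqueBandsSetting — THE END OF GEN 34: #61e's END `theorem2_existsUnique_of_fadingMemory`
# READ AT θ = 1 IS FALSE ON THE AS-PRINTED CARRIER.  The multi-band toy as a `Setting` with `StandingHypotheses ∧ Definitions ∧ Conclusions`
# (so `B12BetaAsPrinted S`), Theorem 2 AS PRINTED (`Theorem2Statement` — it HOLDS), `BetaPertH S.β b`, the AF letters, (C), a UNIFORM history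
# modulus `FadingMemory C 1 Λ` — and, at EVERY depth scale, two distinct bare couplings whose Theorem-3 runs end at the same renormalized coupling
# g_m ↓ 0: for this setting «for small γ, small g and every K there is EXACTLY ONE bare coupling» FAILS (β-flow team, prover 1 = recursion ∕ upper ∕
# bare-coupling ∕ UNIQUENESS side, unit `b2b-balaban-beta-bflow-p1`, gen 34; ROW AP-I·C × ROW U; parts: `…Bands` (family), `…BandsData` (recursion,
# separation), `…Setting` (the single-band setting, whose bookkeeping is repeated here), #60d's toolkit)

HONEST FRAMING (page 1 of everything the β sub-cell writes): discharging `BetaPertH` makes Bałaban's UV stability UNCONDITIONAL — a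
real constructive-QFT result; it is NOT the continuum limit and NOT the Clay problem.  HONEST DEPENDENCY (cell reorg 2026-08-19,
verbatim): «continuum YM on T⁴ ⇐ BetaPertH ∧ nine spine estimates (0/9 proved); BetaPertH ⇐ (D1) ∧ (D4) ∧ CAP+tail; G-an2-4 gates
asym, D1 and NE2/3/4.»  THIS MODULE DISCHARGES NOTHING: ONE TOY SETTING OF OURS of the statement-exact typing of [I] = T. Bałaban, Commun.
Math. Phys. **109** (1987) [Balaban1987RG1] (`B12BetaAsPrinted`, typer unit `b2b-balaban-beta-asprinted`, v1.3 p562908 ✓), built INSIDE AN EXISTENCE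
PROOF (def-free) with the toolkit of #60d `…B12AsPrintedWitness`.  READ THIS TWICE (an4 WORD-62): for the toy THEOREM 2 AS PRINTED HOLDS —
*"there exists a bare coupling constant g₀ = g₀(ε, g)"* (p. 259) is EXISTENCE in function NOTATION —; what FAILS is UNIQUENESS (∃!), which print
does not assert.  The letters (`HistLipschitz ∕ FadingMemory` of node U2's `T4CouplingMatching`, (C), AF, `BetaPertH`) are the cell's HYPOTHESIS SHAPES,
none printed (p. 298: dependence on the preceding couplings exists; no modulus — DELTA-I D-20).  Nothing of Bałaban's β is asserted.

THE TOY.  β_{k+1}(p) := b + Σ_m 𝟙[n_m ≤ k < 2n_m]·ε_m·max(1 − |Σ_{i<n_m}(p_i − gᴮ⁽ᵐ⁾_i)|∕M_m, 0)·smoothTransition(p_k∕τ_m) with the data of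
`bandsData_exists` (targets g_m = min(γ, 1∕(m+1))), 𝐄_int := β − b (vanishes at p_k = 0: `d213`; smooth in p_k: `c264`), Π := β·Re Qᵀ, runs = the forward
table of (0.20), E₀ = b + 1, δ₁ = 1, C510 = MQ(1, 4), C544 = 1, L = 13, flag OFF.

WHAT THIS FILE PROVES (0 sorry, 0 def):
§33 `pert_pointwise_of_bumpFamily` (the `BetaPertH` bound of one band with EXPLICIT constant), **`bandsToy_exists`** (∃ S, StandingHypotheses ∧ Definitions ∧ Conclusions ∧ S.γ = γ ∧ Theorem2Statement ∧ BetaPertH ∧ BetaLowerH b ∧ BetaUpperH (b+b) ∧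
    BetaContH ∧ (HistLipschitz Λ ∧ FadingMemory C 1 Λ) ∧ ∀ m: bare couplings g₀ ≠ g₀′ with `RunHyp` runs of depth K_m BOTH ending at g_m, 0 < g_m ≤ 1∕(m+1)).
§34 **`end_existsUnique_fails`** (for that S and every m: ¬ «∃ γ₂ ∀ γ ≤ γ₂ ∃ g₁ ∀ g ≤ g₁ ∀ K ∃! g₀ …» — the conclusion of #61e's END),
    HEADLINE **`end_fadingMemory_loadBearing`**: #61e `theorem2_existsUnique_of_fadingMemory` with (`FadingMemory C θ Λ`, 0 < θ < 1, smallness) REPLACED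
    by `FadingMemory C 1 Λ` is FALSE — with Theorem2Statement, Definitions, (U), AF, HistLipschitz all KEPT, for every b, C > 0.
NOT CLAIMED: anything about Bałaban's β; that it lacks fading memory; Theorem 2 (it HOLDS for the toy); `BetaPertH` for Bałaban's β; continuum; Clay.
-/

namespace Summit.QuantumFields.BalabanUV.Beta.EriceFlowEnclosureB12AsPrintedHistoryNonuniqueBandsSetting

open Finset
open Literature.MathematicalPhysics.QuantumFieldTheory.GawedzkiKupiainen1985.PeriodicGleason (Pt ExpBound)
open Literature.MathematicalPhysics.QuantumFieldTheory.Balaban1983to89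
open Literature.MathematicalPhysics.QuantumFieldTheory.Balaban1983to89.B12Rep537 (wilsonQ MQ)
open Literature.MathematicalPhysics.QuantumFieldTheory.Balaban1983to89.B12BetaAsPrinted
open Literature.MathematicalPhysics.QuantumFieldTheory.Balaban1983to89.FlowStep (HBeta prefixOf Box mem_box box_mono RGEqH BetaLowerH
  BetaUpperH BetaContH BetaPertH)
open Literature.MathematicalPhysics.QuantumFieldTheory.Balaban1983to89.T4CouplingMatching (HistLipschitz FadingMemory)
open Literature.MathematicalPhysics.QuantumFieldTheory.Balaban1983to89.B12CouplingClausesHistory (BetaSmoothInLast264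
  betaDerivsBoundedInLast264_of_smooth)
open Summit.QuantumFields.BalabanUV.Beta.EriceFlowEnclosureB12AsPrintedMarginal (wilsonQ_perm wilsonQ_neg_transpose)
open Summit.QuantumFields.BalabanUV.Beta.EriceFlowEnclosureB12AsPrintedUpper (theorem2Statement_of_letters)
open Summit.QuantumFields.BalabanUV.Beta.EriceFlowEnclosureB12AsPrintedWitness (secondMoment_toyKernel fourier_toyKernel
  decay510_toyKernel reflect_toyKernel rep537_toyKernel)
open Summit.QuantumFields.BalabanUV.Beta.EriceFlowEnclosureB12AsPrintedLastVar (rep537_diag expBound_zero)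
open Summit.QuantumFields.BalabanUV.Beta.EriceFlowEnclosureB12AsPrintedHistoryNonunique
open Summit.QuantumFields.BalabanUV.Beta.EriceFlowEnclosureB12AsPrintedHistoryNonuniqueRuns
open Summit.QuantumFields.BalabanUV.Beta.EriceFlowEnclosureB12AsPrintedHistoryNonuniqueForward
open Summit.QuantumFields.BalabanUV.Beta.EriceFlowEnclosureB12AsPrintedHistoryNonuniqueBands
open Summit.QuantumFields.BalabanUV.Beta.EriceFlowEnclosureB12AsPrintedHistoryNonuniqueBandsData
open Summit.QuantumFields.BalabanUV.Beta.EriceFlowEnclosureB12AsPrintedHistoryNonuniqueSetting (term_bounds)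

noncomputable section

/-! ## §33 The multi-band toy setting -/

/-- The `BetaPertH` bound of ONE band with EXPLICIT constant: if the bump vanishes on boxes ]0, γ′]^{j+1} with γ′ ≤ τ and ε ≤ C_p·τ², then
|β_{j+1}(v) − b| ≤ C_p·γ′² on every box (scale-wise form of `betaPertH_of_bumpFamily`, whose ∃ hides the constant). [folklore] -/
theorem pert_pointwise_of_bumpFamily {β : HBeta} {b ε M Cp τ : ℝ} {n : ℕ} {gB : ℕ → ℝ} {χ : ℝ → ℝ}
    (hβ : ∀ (j : ℕ) (p : Fin (j + 1) → ℝ), β j p = b + (if n ≤ j ∧ j < 2 * n then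
      ε * max (1 - |∑ i : Fin (j + 1), (if (i : ℕ) < n then p i - gB i else 0)| / M) 0 * χ (p (Fin.last j)) else 0))
    (hε : 0 ≤ ε) (hM : 0 ≤ M) (hχ : ∀ s, 0 ≤ χ s ∧ χ s ≤ 1) (hCp : 0 ≤ Cp) (hτ : 0 < τ)
    (hvan : ∀ γ' : ℝ, 0 < γ' → γ' ≤ τ → ∀ (j : ℕ) (p : Fin (j + 1) → ℝ), n ≤ j → p ∈ Box γ' j →
      max (1 - |∑ i : Fin (j + 1), (if (i : ℕ) < n then p i - gB i else 0)| / M) 0 = 0)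
    (hετ : ε ≤ Cp * τ ^ 2) {γ' : ℝ} (hγ' : 0 < γ') (k : ℕ) {v : Fin (k + 1) → ℝ} (hv : v ∈ Box γ' k) :
    |β k v - b| ≤ Cp * γ' ^ 2 := by
  rw [hβ k v, add_sub_cancel_left]
  split_ifs with hband
  · rcases le_or_gt γ' τ with hle | hlt
    · rw [hvan γ' hγ' hle k v hband.1 hv, mul_zero, zero_mul, abs_zero]; positivity
    · have h1 := bump_mem_Icc (∑ i : Fin (k + 1), (if (i : ℕ) < n then v i - gB i else 0)) hM
      have h2 := hχ (v (Fin.last k))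
      have h3 : max (1 - |∑ i : Fin (k + 1), (if (i : ℕ) < n then v i - gB i else 0)| / M) 0 * χ (v (Fin.last k)) ≤ 1 := by
        calc _ ≤ 1 * 1 := mul_le_mul h1.2 h2.2 h2.1 zero_le_one
          _ = 1 := one_mul 1
      rw [abs_of_nonneg (mul_nonneg (mul_nonneg hε h1.1) h2.1)]
      have hτγ : τ ^ 2 ≤ γ' ^ 2 := pow_le_pow_left₀ hτ.le hlt.le 2
      calc ε * max (1 - |∑ i : Fin (k + 1), (if (i : ℕ) < n then v i - gB i else 0)| / M) 0 * χ (v (Fin.last k))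
          = ε * (max (1 - |∑ i : Fin (k + 1), (if (i : ℕ) < n then v i - gB i else 0)| / M) 0 * χ (v (Fin.last k))) := by ring
        _ ≤ ε * 1 := mul_le_mul_of_nonneg_left h3 hε
        _ ≤ Cp * τ ^ 2 := by rw [mul_one]; exact hετ
        _ ≤ Cp * γ' ^ 2 := mul_le_mul_of_nonneg_left hτγ hCp
  · rw [abs_zero]; positivity

/-- **THE MULTI-BAND TOY SETTING.**  For every b > 0 (AF letter), C > 0 (uniform history modulus), C_p > 0 (`BetaPertH` constant) and Theorem-3 box
γ > 0 there is a `Setting S` with `StandingHypotheses S ∧ Definitions S ∧ Conclusions S`, S.γ = γ, [I] Theorem 2 AS PRINTED (`Theorem2Statement`,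
it HOLDS), `BetaPertH S.β b`, `BetaLowerH b γ S.β`, `BetaUpperH (b + b) γ S.β`, (C) `BetaContH γ S.β`, moduli `HistLipschitz Λ γ S.β` with the UNIFORM
bound `FadingMemory C 1 Λ` — and FOR EVERY m two DIFFERENT bare couplings g₀ ≠ g₀′ whose runs (K_m, 0, g₀), (K_m, 0, g₀′) satisfy Theorem 3's
`RunHyp` and END AT THE SAME g_{K_m} = g_m, with targets 0 < g_m ≤ min(γ, 1∕(m+1)) ↓ 0. [folklore] -/
theorem bandsToy_exists {b C Cp γ : ℝ} (hb : 0 < b) (hC : 0 < C) (hCp : 0 < Cp) (hγ : 0 < γ) :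
    ∃ S : Setting, ∃ hH : StandingHypotheses S, Definitions S ∧ Conclusions S ∧ S.γ = γ ∧
      Theorem2Statement S (hL_of_standing hH) ∧ BetaPertH S.β b ∧ BetaLowerH b γ S.β ∧ BetaUpperH (b + b) γ S.β ∧ BetaContH γ S.β ∧
      (∃ Λ : ℕ → ℕ → ℝ, HistLipschitz Λ γ S.β ∧ FadingMemory C 1 Λ) ∧
      ∃ gb : ℕ → ℝ, (∀ m, 0 < gb m ∧ gb m ≤ γ ∧ gb m ≤ 1 / ((m : ℝ) + 1)) ∧
        ∀ m, ∃ (K : ℕ) (g₀ g₀' : ℝ), g₀ ≠ g₀' ∧ RunHyp S ⟨K, 0, g₀⟩ ∧ RunHyp S ⟨K, 0, g₀'⟩ ∧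
          Step.InInterval (gb m) K (S.cpl ⟨K, 0, g₀⟩) ∧ Step.InInterval (gb m) K (S.cpl ⟨K, 0, g₀'⟩) ∧
          S.cpl ⟨K, 0, g₀⟩ K = gb m ∧ S.cpl ⟨K, 0, g₀'⟩ K = gb m := by
  obtain ⟨nb, x0b, εb, Mb, τb, Lb, gb, gAb, gBb, h0, hsep, hsep9, hgb, hd⟩ := bandsData_exists hb hC hCp hγ
  -- per-band projections of the data
  have hx : ∀ m, b * (2 * nb m) < x0b m := fun m => (hd m).2.2.2.2.2.1
  have hx0 : ∀ m, 0 < x0b m := fun m => (hd m).2.2.2.2.2.2.1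
  have hε0 : ∀ m, 0 < εb m := fun m => (hd m).2.2.1
  have hε1 : ∀ m, εb m ≤ 1 := fun m => (hd m).2.2.2.1
  have hεb : ∀ m, εb m ≤ b := fun m => (hd m).2.2.2.2.1
  have hA : ∀ m i, gAb m i = 1 / Real.sqrt (x0b m - b * i) := fun m => (hd m).2.2.2.2.2.2.2.1
  have hB : ∀ m i, gBb m i = 1 / Real.sqrt (x0b m - b * i + εb m * ((nb m - (i - nb m) : ℕ) : ℝ)) :=
    fun m => (hd m).2.2.2.2.2.2.2.2.1
  have hM : ∀ m, Mb m = ∑ i ∈ range (nb m), (gAb m i - gBb m i) := fun m => (hd m).2.2.2.2.2.2.2.2.2.1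
  have hMpos : ∀ m, 0 < Mb m := fun m => (hd m).2.2.2.2.2.2.2.2.2.2.1
  have hεM : ∀ m, εb m / Mb m ≤ C := fun m => (hd m).2.2.2.2.2.2.2.2.2.2.2.1
  have hL0 : ∀ m, 0 ≤ Lb m := fun m => (hd m).2.2.2.2.2.2.2.2.2.2.2.2.1
  have hεL : ∀ m, εb m * Lb m ≤ C := fun m => (hd m).2.2.2.2.2.2.2.2.2.2.2.2.2.1
  have hτ0 : ∀ m, 0 < τb m := fun m => (hd m).2.2.2.2.2.2.2.2.2.2.2.2.2.2.1
  have hχB : ∀ m j, j ≤ 2 * nb m → Real.smoothTransition (gBb m j / τb m) = 1 := fun m => (hd m).2.2.2.2.2.2.2.2.2.2.2.2.2.2.2.1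
  have hχL : ∀ m s t, s ∈ Set.Icc (0 : ℝ) γ → t ∈ Set.Icc (0 : ℝ) γ →
      |Real.smoothTransition (s / τb m) - Real.smoothTransition (t / τb m)| ≤ Lb m * |s - t| :=
    fun m => (hd m).2.2.2.2.2.2.2.2.2.2.2.2.2.2.2.2.1
  have hΔ54 : ∀ m, εb m * nb m ≤ 5 / 4 * (x0b m - b * (2 * nb m)) := fun m => (hd m).2.2.2.2.2.2.2.2.2.2.2.2.2.2.2.2.2.1
  have hεA : ∀ m, εb m ≤ Cp * (gAb m 0 / 3) ^ 2 := fun m => (hd m).2.2.2.2.2.2.2.2.2.2.2.2.2.2.2.2.2.2.1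
  have hA0 : ∀ m, 0 < gAb m 0 / 3 := fun m => (hd m).2.2.2.2.2.2.2.2.2.2.2.2.2.2.2.2.2.2.2.1
  have hend : ∀ m, gAb m (2 * nb m) = gb m := fun m => (hd m).2.2.2.2.2.2.2.2.2.2.2.2.2.2.2.2.2.2.2.2
  have hdsil : ∀ m, x0b m = 1 / gb m ^ 2 + b * (2 * nb m) ∧
      1 ≤ nb m ∧ 0 < εb m ∧ εb m ≤ 1 ∧ εb m ≤ b ∧ b * (2 * nb m) < x0b m ∧ 0 < x0b m ∧
      (∀ i, gAb m i = 1 / Real.sqrt (x0b m - b * i)) ∧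
      (∀ i, gBb m i = 1 / Real.sqrt (x0b m - b * i + εb m * ((nb m - (i - nb m) : ℕ) : ℝ))) ∧
      Mb m = ∑ i ∈ range (nb m), (gAb m i - gBb m i) ∧ 0 < Mb m ∧ εb m * nb m ≤ 5 / 4 * (x0b m - b * (2 * nb m)) :=
    fun m => ⟨(hd m).1, (hd m).2.1, hε0 m, hε1 m, hεb m, hx m, hx0 m, hA m, hB m, hM m, hMpos m, hΔ54 m⟩
  have hχ01 : ∀ m s, 0 ≤ (fun m s => Real.smoothTransition (s / τb m)) m s ∧ (fun m s => Real.smoothTransition (s / τb m)) m s ≤ 1 :=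
    fun m s => smoothStep_mem_Icc (τb m) s
  -- the banded family and the forward table
  let βt : HBeta := fun k p => b + ∑ m ∈ range (k + 1), (if nb m ≤ k ∧ k < 2 * nb m then
        εb m * max (1 - |∑ i : Fin (k + 1), (if (i : ℕ) < nb m then p i - gBb m i else 0)| / Mb m) 0 *
          (fun m s => Real.smoothTransition (s / τb m)) m (p (Fin.last k)) else 0)
  let tbl : ℝ → ℕ → ℕ → ℝ := fun g₀ => fun k => Nat.rec (motive := fun _ => ℕ → ℝ) (fun _ => g₀)
      (fun k t i => if i ≤ k then t i else 1 / Real.sqrt (1 / (t k) ^ 2 - βt k (fun j : Fin (k + 1) => t j))) k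
  have hβ : ∀ (j : ℕ) (p : Fin (j + 1) → ℝ), βt j p = b + ∑ m ∈ range (j + 1), (if nb m ≤ j ∧ j < 2 * nb m then
        εb m * max (1 - |∑ i : Fin (j + 1), (if (i : ℕ) < nb m then p i - gBb m i else 0)| / Mb m) 0 *
          (fun m s => Real.smoothTransition (s / τb m)) m (p (Fin.last j)) else 0) := fun j p => rfl
  have hcs : ∀ (g₀ : ℝ) (k i : ℕ), tbl g₀ (k + 1) i =
      if i ≤ k then tbl g₀ k i else 1 / Real.sqrt (1 / (tbl g₀ k k) ^ 2 - βt k (fun j : Fin (k + 1) => tbl g₀ k j)) := fun g₀ k i => rfl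
  -- scale-wise sizes: 0 ≤ β − b ≤ 1
  have hsz : ∀ (k : ℕ) (p : Fin (k + 1) → ℝ), 0 ≤ βt k p - b ∧ βt k p - b ≤ 1 := by
    intro k p
    obtain ⟨m, -, hm⟩ := bands_scalewise (χb := fun m s => Real.smoothTransition (s / τb m)) hβ h0 hsep k
    have h := term_bounds (b := b) (n := nb m) (k := k) (gB := gBb m) (χ := fun s => Real.smoothTransition (s / τb m))
      (hε0 m).le (hMpos m).le (hχ01 m) p
    rw [hm p, add_sub_cancel_left]
    exact ⟨h.1, h.2.1.trans (hε1 m)⟩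
  have hsz' : ∀ (k : ℕ) (p : Fin (k + 1) → ℝ), |βt k p| ≤ b + 1 ∧ |βt k p - b| ≤ b + 1 := by
    intro k p
    have h := hsz k p
    refine ⟨?_, ?_⟩
    · rw [abs_of_nonneg (by linarith)]; linarith
    · rw [abs_of_nonneg h.1]; linarith
  let S : Setting := ⟨13, True, 1, fun P k => tbl P.g0 k k, βt, γ, 1, 1, fun _ => Unit, fun _ => (), fun _ _ => b,
      fun k p _ => βt k p - b, fun k p _ => βt k p, fun _ F E => |F ()| ≤ E, 1, 1, b + 1, fun _ => 1,
      fun _ F => fun μ ν x => F () * (wilsonQ ν μ x).re, fun k p => fun μ ν x => βt k p * (wilsonQ ν μ x).re, 1, fun _ _ => True, 1, False,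
      fun k p => βt k p - b, 1, 1, MQ 1 4, 1⟩
  have hH : StandingHypotheses S :=
    { hL := ⟨⟨6, rfl⟩, by show (11 : ℕ) < 13; norm_num⟩, hG := trivial, hκ₀ := by norm_num, hMκ := by norm_num, hγ := hγ,
      hε₀ := by norm_num, hε₁ := by norm_num, hα₀ := by norm_num, hα₁ := by norm_num, hκ := le_rfl, hM := le_rfl }
  -- the face: at p_k = 0 every band term vanishes
  have hface : ∀ (k : ℕ) (p : Fin (k + 1) → ℝ), p (Fin.last k) = 0 → βt k p - b = 0 := by
    intro k p hp
    rw [hβ k p, add_sub_cancel_left]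
    refine Finset.sum_eq_zero fun m _ => ?_
    split_ifs
    · simp only [hp, zero_div, Real.smoothTransition.zero, mul_zero]
    · rfl
  have hD : Definitions S := by
    refine { d018 := fun P => rfl, d020 := ?_, d13 := ?_, d213 := ?_, d214 := fun _ _ => rfl, d120 := fun _ _ => rfl,
             d120split := ?_, d121 := ?_, d122 := ?_ }
    · intro P k _ _ h
      exact fwd_d020 (β := βt) (c := tbl P.g0) (hcs P.g0) k h
    · intro j p U
      show βt j p - βt j p = (b - b) + ((βt j p - b) - (βt j p - b))
      ring
    · intro k p p' hp hp'
      show (fun _ : Unit => βt k p - b) = fun _ : Unit => βt k p' - b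
      rw [hface k p hp, hface k p' hp']
    · intro j p; funext μ ν x; simp only [Pi.add_apply]; ring
    · intro k p
      refine ⟨fun σ μ ν x => congrArg (fun r : ℝ => βt k p * r) (congrArg Complex.re (wilsonQ_perm σ ν μ x)),
        fun ε' hε' μ ν z => reflect_toyKernel _ hε' μ ν z,
        fun μ ν z => congrArg (fun r : ℝ => βt k p * r) (congrArg Complex.re (wilsonQ_neg_transpose ν μ z).symm)⟩
    · intro j p _ μ ν hμν
      exact ⟨(fourier_toyKernel hμν _).symm, (secondMoment_toyKernel hμν _).symm⟩
  -- p. 264 smoothness, scale-wise from the active band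
  have hSm : BetaSmoothInLast264 γ βt := by
    intro k p hp nn
    obtain ⟨m, -, hm⟩ := bands_scalewise (χb := fun m s => Real.smoothTransition (s / τb m)) hβ h0 hsep k
    have h := betaSmoothInLast264_of_bumpFamily (b := b) (ε := εb m) (M := Mb m) (τ := τb m) (n := nb m) (gB := gBb m)
      (β := fun j p => b + (if nb m ≤ j ∧ j < 2 * nb m then
        εb m * max (1 - |∑ i : Fin (j + 1), (if (i : ℕ) < nb m then p i - gBb m i else 0)| / Mb m) 0 *
          (fun s : ℝ => Real.smoothTransition (s / τb m)) (p (Fin.last j)) else 0))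
      (fun _ _ => rfl) γ k p hp nn
    have hfun : (fun s : ℝ => βt k (Function.update p (Fin.last k) s))
        = fun s : ℝ => (fun (j : ℕ) (p : Fin (j + 1) → ℝ) => b + (if nb m ≤ j ∧ j < 2 * nb m then
        εb m * max (1 - |∑ i : Fin (j + 1), (if (i : ℕ) < nb m then p i - gBb m i else 0)| / Mb m) 0 *
          (fun s : ℝ => Real.smoothTransition (s / τb m)) (p (Fin.last j)) else 0)) k (Function.update p (Fin.last k) s) := by
      funext s; exact hm _
    rw [hfun]; exact h
  have hCo : Conclusions S := by
    refine { c13 := fun _ _ _ _ => trivial, c118 := fun P _ j _ s hs => ⟨(hsz' j _).1, (hsz' j _).2⟩, c264 := ?_, c510 := ?_, c537 := ?_ }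
    · intro P hP j hj
      exact ⟨fun m => smooth264_of_box hSm hP.inInterval hj m, fun h => h.elim,
        fun m => derivBound264_of_box (betaDerivsBoundedInLast264_of_smooth hγ hSm) hP.inInterval hj m⟩
    · refine ⟨by norm_num, fun j F E hF μ ν x => ?_⟩
      have hF' : |F ()| ≤ E := hF
      have hd' := decay510_toyKernel (d := 4) (F ()) μ ν x
      have hMQ := B12Rep537.MQ_nonneg 1 4
      show |F () * (wilsonQ ν μ x).re| ≤ MQ 1 4 * E * Real.exp (-1 * B12Sec2to5.l1 x)
      calc |F () * (wilsonQ ν μ x).re| ≤ |F ()| * MQ 1 4 * Real.exp (-1 * B12Sec2to5.l1 x) := hd'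
        _ ≤ E * MQ 1 4 * Real.exp (-1 * B12Sec2to5.l1 x) := by gcongr
        _ = MQ 1 4 * E * Real.exp (-1 * B12Sec2to5.l1 x) := by ring
    · intro P _ j _ s _ μ ν
      by_cases hμν : μ = ν
      · subst hμν
        exact ⟨fun _ _ => 0, fun x => rep537_diag _ μ x, fun w => expBound_zero _ _ (by positivity)⟩
      · obtain ⟨rem, hrep, hdec⟩ := rep537_toyKernel (d := 4) hμν (βt j (sectionHist S P j s)) (1 / 2)
        refine ⟨rem, hrep, fun w => (hdec w).mono ?_⟩
        show |βt j (sectionHist S P j s)| ≤ 1 * (b + 1)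
        rw [one_mul]; exact (hsz' j _).1
  -- the letters of the banded β
  have hlo : BetaLowerH b γ S.β :=
    betaLowerH_of_bands (χb := fun m s => Real.smoothTransition (s / τb m)) hβ h0 hsep (fun m => (hε0 m).le) (fun m => (hMpos m).le) hχ01 γ
  have hup : BetaUpperH (b + b) γ S.β :=
    betaUpperH_of_bands (χb := fun m s => Real.smoothTransition (s / τb m)) hβ h0 hsep (fun m => (hε0 m).le) hεb
      (fun m => (hMpos m).le) hχ01 γ
  have hcont : BetaContH γ S.β :=
    betaContH_of_bands (χb := fun m s => Real.smoothTransition (s / τb m)) hβ h0 hsep (fun m => smoothStep_continuous (τb m)) γ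
  have hpert : BetaPertH S.β b := by
    refine ⟨γ, hγ, Cp, hCp.le, fun γ' hγ' _ k v hv => ?_⟩
    obtain ⟨m, -, hm⟩ := bands_scalewise (χb := fun m s => Real.smoothTransition (s / τb m)) hβ h0 hsep k
    have h := pert_pointwise_of_bumpFamily (b := b) (ε := εb m) (M := Mb m) (Cp := Cp) (τ := gAb m 0 / 3) (n := nb m) (gB := gBb m)
      (χ := fun s => Real.smoothTransition (s / τb m))
      (β := fun j p => b + (if nb m ≤ j ∧ j < 2 * nb m then
        εb m * max (1 - |∑ i : Fin (j + 1), (if (i : ℕ) < nb m then p i - gBb m i else 0)| / Mb m) 0 *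
          (fun s : ℝ => Real.smoothTransition (s / τb m)) (p (Fin.last j)) else 0))
      (fun _ _ => rfl) (hε0 m).le (hMpos m).le (hχ01 m) hCp.le (hA0 m)
      (fun γ'' hγ'' hγ''τ j p hj hp => bump_zero_of_smallBox (hM m) (hMpos m)
        (twoThirds_runB (hA m) (hB m) hb.le (hε0 m).le (hx m) (hΔ54 m) hγ''τ) (by omega) hp) (hεA m) hγ' k hv
    show |βt k v - b| ≤ Cp * γ' ^ 2
    rw [hm v]; exact h
  -- the runs of every band ARE the setting's runs from their bare couplings
  have hrgA : ∀ m, RGEqH (2 * nb m) βt (gAb m) := fun m =>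
    rgEqH_of_bands_runA (χb := fun m s => Real.smoothTransition (s / τb m)) hβ h0 hsep hb.le (hA m) (hx m) (hM m) (hMpos m)
      (silent_runA hb hsep hsep9 hdsil)
  have hrgB : ∀ m, RGEqH (2 * nb m) βt (gBb m) := fun m =>
    rgEqH_of_bands_runB (χb := fun m s => Real.smoothTransition (s / τb m)) hβ h0 hsep hb.le (hε0 m).le (hB m) (hx m)
      (fun j _ hj => hχB m j hj.le) (silent_runB hb hsep hsep9 hdsil)
  have hboxes : ∀ m, (∀ i, i ≤ 2 * nb m → 0 < gAb m i ∧ gAb m i ≤ gAb m (2 * nb m)) ∧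
      (∀ i, i ≤ 2 * nb m → 0 < gBb m i ∧ gBb m i ≤ gAb m (2 * nb m)) := fun m => runs_box (hA m) (hB m) hb.le (hε0 m).le (hx m)
  have hcA : ∀ m k, k ≤ 2 * nb m → S.cpl ⟨2 * nb m, 0, gAb m 0⟩ k = gAb m k := fun m =>
    fwd_eq_of_rgEqH (β := βt) (c := tbl (gAb m 0)) (hcs (gAb m 0)) rfl (hrgA m) fun i hi => ((hboxes m).1 i hi).1
  have hcB : ∀ m k, k ≤ 2 * nb m → S.cpl ⟨2 * nb m, 0, gBb m 0⟩ k = gBb m k := fun m =>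
    fwd_eq_of_rgEqH (β := βt) (c := tbl (gBb m 0)) (hcs (gBb m 0)) rfl (hrgB m) fun i hi => ((hboxes m).2 i hi).1
  have hgγ : ∀ m, gAb m (2 * nb m) ≤ γ := fun m => (hend m).le.trans (hgb m).2.1
  have hrunA : ∀ m, RunHyp S ⟨2 * nb m, 0, gAb m 0⟩ := by
    intro m
    refine ⟨fun k hk => ?_, fun k hk => ?_⟩
    · have hk' : k < 2 * nb m := hk
      have hpre : prefixOf (S.cpl ⟨2 * nb m, 0, gAb m 0⟩) k = prefixOf (gAb m) k := by
        funext i; simp only [FlowStep.prefixOf_apply]; exact hcA m i (by have := i.isLt; omega)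
      rw [hcA m k hk'.le, hcA m (k + 1) hk', hpre]; exact hrgA m k hk'
    · have hk' : k ≤ 2 * nb m := hk
      rw [hcA m k hk']; exact ⟨((hboxes m).1 k hk').1, ((hboxes m).1 k hk').2.trans (hgγ m)⟩
  have hrunB : ∀ m, RunHyp S ⟨2 * nb m, 0, gBb m 0⟩ := by
    intro m
    refine ⟨fun k hk => ?_, fun k hk => ?_⟩
    · have hk' : k < 2 * nb m := hk
      have hpre : prefixOf (S.cpl ⟨2 * nb m, 0, gBb m 0⟩) k = prefixOf (gBb m) k := by
        funext i; simp only [FlowStep.prefixOf_apply]; exact hcB m i (by have := i.isLt; omega)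
      rw [hcB m k hk'.le, hcB m (k + 1) hk', hpre]; exact hrgB m k hk'
    · have hk' : k ≤ 2 * nb m := hk
      rw [hcB m k hk']; exact ⟨((hboxes m).2 k hk').1, ((hboxes m).2 k hk').2.trans (hgγ m)⟩
  refine ⟨S, hH, hD, hCo, rfl, theorem2Statement_of_letters hH hD hγ hb (by linarith) hcont hlo hup, hpert, hlo, hup, hcont,
    ⟨_, histLipschitz_of_bands (χb := fun m s => Real.smoothTransition (s / τb m)) hβ h0 hsep (fun m => (hε0 m).le) hMpos hχ01 hχL,
      uniformModulus_of_bands h0 hsep (fun m => (hε0 m).le) hMpos hL0 hεM hεL⟩,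
    gb, hgb, fun m => ⟨2 * nb m, gAb m 0, gBb m 0, (ne_of_lt (runs_start_lt (hA m) (hB m) hb.le (hε0 m) (hx m) (hd m).2.1)).symm,
      hrunA m, hrunB m, fun k hk => ?_, fun k hk => ?_, ?_, ?_⟩⟩
  · rw [hcA m k hk, ← hend m]; exact (hboxes m).1 k hk
  · rw [hcB m k hk, ← hend m]; exact (hboxes m).2 k hk
  · rw [hcA m (2 * nb m) le_rfl]; exact hend m
  · rw [hcB m (2 * nb m) le_rfl, ← runs_end_eq (hA m) (hB m)]; exact hend m

/-! ## §34 Headline: the END at θ = 1 is false on the carrier -/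

/-- **For the multi-band toy the conclusion of #61e's END FAILS** (lattice parameter m₀ = 0): there is NO γ₂ > 0 such that for all γ ≤ γ₂ some
g₁ > 0 makes the in-interval tuned bare coupling unique for all g ≤ g₁ and all K — every threshold is undercut by a band with target g_m below
it, where two bare couplings have in-interval runs ending at g_m. [folklore] -/
theorem end_existsUnique_fails {S : Setting} {gb : ℕ → ℝ} (hgb : ∀ m, 0 < gb m ∧ gb m ≤ 1 / ((m : ℝ) + 1))
    (hruns : ∀ m, ∃ (K : ℕ) (g₀ g₀' : ℝ), g₀ ≠ g₀' ∧
      Step.InInterval (gb m) K (S.cpl ⟨K, 0, g₀⟩) ∧ Step.InInterval (gb m) K (S.cpl ⟨K, 0, g₀'⟩) ∧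
      S.cpl ⟨K, 0, g₀⟩ K = gb m ∧ S.cpl ⟨K, 0, g₀'⟩ K = gb m) :
    ¬ (∃ γ₂ : ℝ, 0 < γ₂ ∧ ∀ γ' : ℝ, 0 < γ' → γ' ≤ γ₂ → ∃ g₁ : ℝ, 0 < g₁ ∧ ∀ g : ℝ, 0 < g → g ≤ g₁ → ∀ K : ℕ,
      ∃! g₀ : ℝ, Step.InInterval γ' K (S.cpl ⟨K, 0, g₀⟩) ∧ S.cpl ⟨K, 0, g₀⟩ K = g) := by
  rintro ⟨γ₂, hγ₂, H⟩
  obtain ⟨g₁, hg₁, H'⟩ := H γ₂ hγ₂ le_rfl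
  -- a band with target below min(g₁, γ₂)
  set δ : ℝ := min g₁ γ₂ with hδ
  have hδ0 : 0 < δ := lt_min hg₁ hγ₂
  obtain ⟨m, hm⟩ := exists_nat_gt (1 / δ)
  have hgm : gb m ≤ δ := by
    have h1 : 1 / ((m : ℝ) + 1) ≤ δ := by
      rw [div_le_iff₀ (by positivity)]
      have := (div_lt_iff₀ hδ0).mp hm
      nlinarith
    exact (hgb m).2.trans h1
  obtain ⟨K, g₀, g₀', hne, hI, hI', hend, hend'⟩ := hruns m
  have hgmg₁ : gb m ≤ g₁ := hgm.trans (min_le_left _ _)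
  have hgmγ₂ : gb m ≤ γ₂ := hgm.trans (min_le_right _ _)
  obtain ⟨x, -, huniq⟩ := H' (gb m) (hgb m).1 hgmg₁ K
  have hIγ : Step.InInterval γ₂ K (S.cpl ⟨K, 0, g₀⟩) := fun k hk => ⟨(hI k hk).1, (hI k hk).2.trans hgmγ₂⟩
  have hIγ' : Step.InInterval γ₂ K (S.cpl ⟨K, 0, g₀'⟩) := fun k hk => ⟨(hI' k hk).1, (hI' k hk).2.trans hgmγ₂⟩
  exact hne ((huniq g₀ ⟨hIγ, hend⟩).trans (huniq g₀' ⟨hIγ', hend'⟩).symm)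

/-- **HEADLINE — FADING MEMORY IS LOAD-BEARING IN #61e's END `theorem2_existsUnique_of_fadingMemory`.**  That END with its fading-memory input
(`FadingMemory C θ Λ`, 0 < θ < 1, smallness C(γ₁³ + 2γ₁∕b) ≤ (1 − θ)∕2) REPLACED by the UNIFORM modulus `FadingMemory C 1 Λ` — every other hypothesis
KEPT (`Theorem2Statement`, `Definitions`, the box-wide (U) `BetaUpperH b′`, the AF letter `BetaLowerH b`, `HistLipschitz Λ`, the box size γ₁ with
b′γ₁² < 1) — is FALSE, for every b > 0 and C > 0: the multi-band toy satisfies all of them (and `StandingHypotheses ∧ Conclusions ∧ BetaPertH ∧ (C)`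
besides) while «∃! g₀» fails at arbitrarily small renormalized couplings.  In the history reading of [I] the K-UNIFORM existence-AND-uniqueness of
Theorem 2's «g₀(ε, g)» needs DECAY of the moduli in the age (node U2's θ < 1) or Markov-type feedback; a uniform coordinatewise modulus does not
suffice, and print (p. 298; DELTA-I D-20) gives none at all. [cite: Balaban1987RG1, Thm 2 (0.31) p.259 («g₀ = g₀(ε, g)») with (0.18)–(0.20) pp.255–256 and p.298] -/
theorem end_fadingMemory_loadBearing {b C : ℝ} (hb : 0 < b) (hC : 0 < C) :
    ¬ (∀ (S : Setting) (hL : Odd S.L ∧ 1 < S.L), Theorem2Statement S hL → Definitions S →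
        ∀ (γu γ₁ b' : ℝ) (Λ : ℕ → ℕ → ℝ), BetaUpperH b' γu S.β → BetaLowerH b γu S.β →
        HistLipschitz Λ γu S.β → FadingMemory C 1 Λ → 0 < γ₁ → γ₁ ≤ γu → b' * γ₁ ^ 2 < 1 →
        ∀ m : ℕ, ∃ γ₂ : ℝ, 0 < γ₂ ∧ ∀ γ : ℝ, 0 < γ → γ ≤ γ₂ → ∃ g₁ : ℝ, 0 < g₁ ∧ ∀ g : ℝ, 0 < g → g ≤ g₁ → ∀ K : ℕ,
          ∃! g₀ : ℝ, Step.InInterval γ K (S.cpl ⟨K, m, g₀⟩) ∧ S.cpl ⟨K, m, g₀⟩ K = g) := by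
  intro h
  obtain ⟨S, hH, hD, -, -, hT2, -, hlo, hup, -, ⟨Λ, hL, hΛ⟩, gb, hgb, hruns⟩ := bandsToy_exists (γ := 1) hb hC hb one_pos
  -- the box size γ₁ := min 1 (1∕(2b + 1)) has (b + b)·γ₁² < 1
  have hγ₁ : 0 < min (1 : ℝ) (1 / (2 * b + 1)) := lt_min one_pos (by positivity)
  have hbu : (b + b) * (min (1 : ℝ) (1 / (2 * b + 1))) ^ 2 < 1 := by
    set t : ℝ := min (1 : ℝ) (1 / (2 * b + 1)) with ht
    have ht1 : t ≤ 1 := min_le_left _ _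
    have ht2 : t ≤ 1 / (2 * b + 1) := min_le_right _ _
    have ht0 : 0 < t := hγ₁
    have h1 : t ^ 2 ≤ t := by nlinarith
    have h2 : (b + b) * t ≤ (2 * b) / (2 * b + 1) := by
      rw [le_div_iff₀ (by positivity)]
      have := mul_le_mul_of_nonneg_left ht2 (by positivity : (0 : ℝ) ≤ (b + b) * (2 * b + 1))
      rw [mul_one_div, mul_div_assoc, div_self (by positivity : (2 : ℝ) * b + 1 ≠ 0), mul_one] at this
      linarith
    have h3 : (2 * b) / (2 * b + 1) < 1 := by rw [div_lt_one (by positivity)]; linarith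
    nlinarith
  have hconc := h S (hL_of_standing hH) hT2 hD 1 (min (1 : ℝ) (1 / (2 * b + 1))) (b + b) Λ
    hup hlo hL hΛ hγ₁ (min_le_left _ _) hbu 0
  exact end_existsUnique_fails (fun m => ⟨(hgb m).1, (hgb m).2.2⟩)
    (fun m => by obtain ⟨K, g₀, g₀', hne, -, -, hI, hI', he, he'⟩ := hruns m; exact ⟨K, g₀, g₀', hne, hI, hI', he, he'⟩) hconc

end

end Summit.QuantumFields.BalabanUV.Beta.EriceFlowEnclosureB12AsPrintedHistoryNonuniqueBandsSetting
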